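import Mathlib
import HarnessLib
import Summits.HubbardSuperconductivity.HubbardSuperconductivity.Theorems.KLProgrammeC4aRadialRowOne
import Summits.HubbardSuperconductivity.HubbardSuperconductivity.Theorems.KLProgrammePerturbedFermiCurveNormalAngleLevelGap

/-!
# Route `KLProgramme` — crux C4a, S3 brick (B2-trans)(b) GEOMETRY, part 2: the GAUSS-MAP LAW for the crossing slopes of the co-moving chart —
# `|De_K(Φ(ρ,ψ))[∂_sΦ(e,χ)]| ≥ (2/π)(Dt_min − 2A)u_min·(c_K·min(‖ψ − χ‖_𝕋, ‖ψ − χ − π‖_𝕋) − πKc|ρ − e|/(Dt_min − 2A)²)`, in particular the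
# transversality numbers `T_k, T_q` of the two direct crossings are `≳ dist(ϑ, {0, π}) − O(|ρ|)`

Cell `gate-hubbard-kl`, seat hubbard-kl-k3c3-p3 g19 (row «implicit-function / monotonicity route for μ(n)»); helper for stub (C) `stub_twoLeg_curvature` of the
engine-flow child `KLRegimeEngineV17F2` (stmt-HubbardSuperconductivity-20437): item (B2-trans) of lane hubbard-kl-c4a-1's S3 plan (memo C4A-PLAN.md §24.10:
«|T| ≳ a_min·dist(ϑ,{0,π}) by a Gauss-map rate; K-frame: perturb by A»; this row's note HOME/hubbard-kl-k3c3-p3/B2TRANS-UMKLAPP.md §3 L2).  The Gauss-map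
geometry is k3c2-p2's (thin-shell level curves of an admissible frame: `…SlopeNormalForm`, `…GaussMapHalfTorus`, `…NormalAngleLevelGap`); this file is the
BRIDGE to c4a-1's chart vocabulary `levelPoint μ K ρ ψ` / `iteratedDeriv 1 (levelPoint μ K e) χ` / `fderiv ℝ (frameLevel μ K)` and the packaging as a LOWER bound:
* §1 `smul_dir_frame_eq_VXE` (the chart tangent `u′·dir χ + u·dir(χ+π/2)` is p4's `(X_E′, Y_E′)`), **`fderiv_frameLevel_levelPoint_tangent_eq_slopeForm`** — the crossing
  slope `De_K(Φ(ρ,ψ))[∂_sΦ(e,χ)]` IS k3c2-p2's slope form `ℓ_{p₁(ψ)}(v₂(χ))` of the level-`(μ+ρ)` point against the level-`(μ+e)` tangent;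
* §2 **`abs_fderiv_frameLevel_levelPoint_tangent_ge`** — under `GeomConstants (frameLevel μ K) Kc r₀ g₀ w` (clause (i) of `FrameOK`) and `|e| < r₀`:
  `(2/π)(Dt_min − 2A)u_min·(u_min·w/(4+2A)·min(‖ψ−χ‖_𝕋, ‖ψ−χ−π‖_𝕋) − π·Kc·|ρ − e|/(Dt_min − 2A)²) ≤ |De_K(Φ(ρ,ψ))[∂_sΦ(e,χ)]|`
  (`angle_alternative_level_of_geomConstants` read backwards); `…_of_frameOK` with the engine's numbers `Kc = 7, r₀ = 3/80, w = 3/200`;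
* §3 **`abs_transversality_pp_at_k_ge`**, **`abs_transversality_pp_at_q_ge`** — the two direct crossings of the pp loop (c4a-1's `deriv_partnerBand_pp_angle_at_k/_at_q`):
  `|T_k|, |T_q| ≥ (2/π)(Dt_min−2A)u_min·(c_K·min(‖ϑ‖_𝕋, ‖ϑ−π‖_𝕋) − πKc|ρ|/(Dt_min−2A)²)` — vanishing allowed ONLY at (T) `ϑ ≡ 0`, (C) `ϑ ≡ π`, up to `O(|ρ|)`.
Everything proved on landed objects; binders = c4a-1's (`hA`, `hd`, tube `r` with `hlo/hhi`); nothing about the model's sizes; nothing asserts superconductivity.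
References: BGM 2003 §7.1 Lemma 7.1 (A1.9) [cite: BenfattoGiulianiMastropietro2003]; FST II CPAM 51 (1998) App. B [cite: FeldmanSalmhoferTrubowitz1998];
BGM 2006 §2.4 Lemma 2.1 (2.40) [cite: BenfattoGiulianiMastropietro2006].
-/

noncomputable section

namespace Summit.HubbardSuperconductivity.HubbardSuperconductivity.Theorems.C4a

set_option linter.dupNamespace false -- summit = problem name (single-conjunct summit), D-0017

open Real Set
open Literature.MathematicalPhysics.QuantumLattice Literature.MathematicalPhysics.QuantumLattice.BandSectorCounting
open Literature.MathematicalPhysics.QuantumLattice.FermiRG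
open Summit.HubbardSuperconductivity.HubbardSuperconductivity.Theorems.KLRegimeSplit
open Summit.HubbardSuperconductivity.HubbardSuperconductivity.Theorems.DispersionFlow
open Summit.HubbardSuperconductivity.HubbardSuperconductivity.Theorems.PerturbedFermiCurve

/-! ## §1 The crossing slope of the chart is the slope form -/

/-- `‖−x‖_𝕋 = ‖x‖_𝕋`. -/
theorem torusDist_neg' (x : ℝ) : torusDist (-x) = torusDist x := by
  simp only [FermiRG.torusDist, AddCircle.coe_neg, norm_neg]

/-- The chart tangent in p4's coordinates: `u′(χ)·dir χ + u(χ)·dir(χ + π/2) = (X_E′(χ), Y_E′(χ))`. -/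
theorem smul_dir_frame_eq_VXE (u : ℝ → ℝ) (χ : ℝ) :
    deriv u χ • dir χ + u χ • dir (χ + π / 2) = ![VXE u χ, VYE u χ] := by
  funext i
  fin_cases i
  · simp [dir, VXE, Real.cos_add_pi_div_two]; ring
  · simp [dir, VYE, Real.sin_add_pi_div_two]

section Sizes

variable {K : TrigPolyC4v} {A : ℝ} (hA : ∀ p : Momentum, ∀ j ≤ 2, ‖iteratedFDeriv ℝ j (frameShift K) p‖ ≤ A)
  (hd : klCurveD ≤ (bandBounds (show (-4 : ℝ) < -1.1 by norm_num) (show (-1.1 : ℝ) ≤ -0.1 by norm_num)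
    (show (-0.1 : ℝ) < 0 by norm_num)).Dtmin - 2 * A)
  {μ r : ℝ} (hr : 0 < r) (hlo : (-1.1 : ℝ) < μ - r - A) (hhi : μ + r + A < -0.1)
include hA hd hr hlo hhi

omit hr in
/-- **The crossing slope is the slope form**: for tube levels `ρ, e` and angles `ψ, χ`,
`De_K(Φ(ρ,ψ))[∂_sΦ(e,χ)] = 2 sin X₁(ψ)·X₂′(χ) + 2 sin Y₁(ψ)·Y₂′(χ) + Dδ_K(p₁(ψ))[(X₂′, Y₂′)(χ)]` with `u₁ = u_K(μ+ρ;·)`, `u₂ = u_K(μ+e;·)`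
the canonical radius functions of the two level curves. [cite: BenfattoGiulianiMastropietro2003, §7.1 (A1.9)] -/
theorem fderiv_frameLevel_levelPoint_tangent_eq_slopeForm {ρ e : ℝ} (he : |e| < r) (ψ χ : ℝ) :
    fderiv ℝ (frameLevel μ K) (levelPoint μ K ρ ψ) (iteratedDeriv 1 (levelPoint μ K e) χ) =
      2 * Real.sin (XE (perturbedFermiRadius (fun k : Fin 2 → ℝ => -K.eval k) (μ + ρ)) ψ) *
          VXE (perturbedFermiRadius (fun k : Fin 2 → ℝ => -K.eval k) (μ + e)) χ +
        2 * Real.sin (YE (perturbedFermiRadius (fun k : Fin 2 → ℝ => -K.eval k) (μ + ρ)) ψ) *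
          VYE (perturbedFermiRadius (fun k : Fin 2 → ℝ => -K.eval k) (μ + e)) χ +
        fderiv ℝ (fun k : Fin 2 → ℝ => -K.eval k) (perturbedFermiRadius (fun k : Fin 2 → ℝ => -K.eval k) (μ + ρ) ψ • dir ψ)
          ![VXE (perturbedFermiRadius (fun k : Fin 2 → ℝ => -K.eval k) (μ + e)) χ,
            VYE (perturbedFermiRadius (fun k : Fin 2 → ℝ => -K.eval k) (μ + e)) χ] := by
  have h1 : (-1.1 : ℝ) ≤ μ + e - A := by have := (abs_lt.1 he).1; linarith
  have h2 : μ + e + A ≤ -0.1 := by have := (abs_lt.1 he).2; linarith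
  rw [iteratedDeriv_one_levelPoint hA hd h1 h2 χ, smul_dir_frame_eq_VXE, levelPoint_eq_toLp_smul_dir, fderiv_frameLevel_toLp]
  simp [XE, YE, dir]

/-! ## §2 The Gauss-map law: a LOWER bound for every crossing slope -/

omit hr in
/-- **GAUSS-MAP LAW for the crossing slopes (lower bound)**.  Under clause (i) of `FrameOK` — `GeomConstants (frameLevel μ K) Kc r₀ g₀ w` — for tube levels `ρ, e` with
`|e| < r₀` (the tangent's curve inside the strict-convexity tube) and any angles `ψ, χ`:
`(2/π)(Dt_min − 2A)u_min·((u_min·w/(4+2A))·min(‖ψ − χ‖_𝕋, ‖ψ − χ − π‖_𝕋) − π·Kc·|ρ − e|/(Dt_min − 2A)²) ≤ |De_K(Φ(ρ,ψ))[∂_sΦ(e,χ)]|` —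
the slope is small ONLY when the two angles agree mod `π` (up to the level gap).  (`u_min`, `Dt_min` of `bandBounds (-1.1) (-0.1)`.)
[cite: BenfattoGiulianiMastropietro2003, §7.1 Lemma 7.1 (A1.9)] -/
theorem abs_fderiv_frameLevel_levelPoint_tangent_ge {Kc r₀ g₀ w : ℝ} (hG : GeomConstants (frameLevel μ K) Kc r₀ g₀ w)
    {ρ e : ℝ} (hρ : |ρ| < r) (he : |e| < r) (he₀ : |e| < r₀) (ψ χ : ℝ) :
    2 / π * (((bandBounds (show (-4 : ℝ) < -1.1 by norm_num) (show (-1.1 : ℝ) ≤ -0.1 by norm_num) (show (-0.1 : ℝ) < 0 by norm_num)).Dtmin - 2 * A) *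
        (bandBounds (show (-4 : ℝ) < -1.1 by norm_num) (show (-1.1 : ℝ) ≤ -0.1 by norm_num) (show (-0.1 : ℝ) < 0 by norm_num)).umin) *
      ((bandBounds (show (-4 : ℝ) < -1.1 by norm_num) (show (-1.1 : ℝ) ≤ -0.1 by norm_num) (show (-0.1 : ℝ) < 0 by norm_num)).umin * w /
            (4 + 2 * A) * min (torusDist (ψ - χ)) (torusDist (ψ - χ - π)) -
        π * Kc * |ρ - e| / ((bandBounds (show (-4 : ℝ) < -1.1 by norm_num) (show (-1.1 : ℝ) ≤ -0.1 by norm_num)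
          (show (-0.1 : ℝ) < 0 by norm_num)).Dtmin - 2 * A) ^ 2) ≤
      |fderiv ℝ (frameLevel μ K) (levelPoint μ K ρ ψ) (iteratedDeriv 1 (levelPoint μ K e) χ)| := by
  set B := bandBounds (show (-4 : ℝ) < -1.1 by norm_num) (show (-1.1 : ℝ) ≤ -0.1 by norm_num) (show (-0.1 : ℝ) < 0 by norm_num) with hBdef
  set δK : (Fin 2 → ℝ) → ℝ := fun k => -K.eval k with hδK
  have hADt : 2 * A < B.Dtmin := by have := klCurveD_pos; linarith
  -- frame data in the form the Gauss-map lemmas want (`κ₀ = A`, `κ₁ = 2A`)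
  have hδc : Continuous δK := by rw [hδK, ← frameShift_toLp_eq_neg_eval]; exact continuous_frameShift_toLp K
  have hδ : ∀ k : Fin 2 → ℝ, (∀ i, |k i| ≤ π) → |δK k| ≤ A := fun k _ => by
    simpa [hδK, frameShift_toLp] using abs_frameShift_toLp_le hA k
  have hκ : ∀ k : Fin 2 → ℝ, (∀ i, |k i| ≤ π) → ‖fderiv ℝ δK k‖ ≤ 2 * A := fun k _ => by
    rw [hδK, ← frameShift_toLp_eq_neg_eval]; exact norm_fderiv_frameShift_toLp_le hA k
  have hρ1 := (abs_lt.1 hρ).1; have hρ2 := (abs_lt.1 hρ).2; have he1 := (abs_lt.1 he).1; have he2 := (abs_lt.1 he).2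
  have hlo₁ : (-1.1 : ℝ) ≤ μ + ρ - A := by linarith
  have hhi₁ : μ + ρ + A ≤ -0.1 := by linarith
  have hlo₂ : (-1.1 : ℝ) ≤ μ + e - A := by linarith
  have hhi₂ : μ + e + A ≤ -0.1 := by linarith
  have hu₁ := isBandFermiRadius_perturbedFermiRadius B hδc hδ hlo₁ hhi₁
  have hu₂ := isBandFermiRadius_perturbedFermiRadius B hδc hδ hlo₂ hhi₂
  have hν₂ : |μ + e - μ| < r₀ := by simpa using he₀
  have h := angle_alternative_level_of_geomConstants B hδ hκ hADt hG hlo₁ hhi₁ hu₁ hlo₂ hhi₂ hu₂ rfl rfl hν₂ ψ χ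
  rw [← fderiv_frameLevel_levelPoint_tangent_eq_slopeForm hA hd hlo hhi he ψ χ] at h
  set ℓ := fderiv ℝ (frameLevel μ K) (levelPoint μ K ρ ψ) (iteratedDeriv 1 (levelPoint μ K e) χ) with hℓ
  have hD : 0 < (B.Dtmin - 2 * A) * B.umin := mul_pos (by linarith) B.umin_pos
  have hπ := Real.pi_pos
  have e1 : |μ + ρ - (μ + e)| = |ρ - e| := by congr 1; ring
  rw [e1] at h
  -- `h : cK·m ≤ (π/2)|ℓ|/D + gap`; solve for `|ℓ|`
  have h' : (B.Dtmin - 2 * A) * B.umin * (B.umin * w / (4 + 2 * A) * min (torusDist (ψ - χ)) (torusDist (ψ - χ - π)) -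
      π * Kc * |ρ - e| / (B.Dtmin - 2 * A) ^ 2) ≤ π / 2 * |ℓ| := by
    have h2 := sub_le_iff_le_add.2 h
    calc _ ≤ (B.Dtmin - 2 * A) * B.umin * (π / 2 * |ℓ| / ((B.Dtmin - 2 * A) * B.umin)) :=
          mul_le_mul_of_nonneg_left h2 hD.le
      _ = π / 2 * |ℓ| := by rw [mul_comm]; exact div_mul_cancel₀ _ hD.ne'
  calc 2 / π * ((B.Dtmin - 2 * A) * B.umin) * (B.umin * w / (4 + 2 * A) * min (torusDist (ψ - χ)) (torusDist (ψ - χ - π)) -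
        π * Kc * |ρ - e| / (B.Dtmin - 2 * A) ^ 2)
      = 2 / π * ((B.Dtmin - 2 * A) * B.umin * (B.umin * w / (4 + 2 * A) * min (torusDist (ψ - χ)) (torusDist (ψ - χ - π)) -
        π * Kc * |ρ - e| / (B.Dtmin - 2 * A) ^ 2)) := by ring
    _ ≤ 2 / π * (π / 2 * |ℓ|) := mul_le_mul_of_nonneg_left h' (by positivity)
    _ = |ℓ| := by field_simp

omit hr in
/-- **The same under `FrameOK`** (the engine's numbers `Kc = 7`, `r₀ = 3/80`, `w = 3/200`; tangent level `|e| < 3/80`). -/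
theorem abs_fderiv_frameLevel_levelPoint_tangent_ge_of_frameOK {R : RenConsts} {U : ℝ} {N : ℕ} (hF : FrameOK R U N μ K)
    {ρ e : ℝ} (hρ : |ρ| < r) (he : |e| < r) (he₀ : |e| < 3 / 80) (ψ χ : ℝ) :
    2 / π * (((bandBounds (show (-4 : ℝ) < -1.1 by norm_num) (show (-1.1 : ℝ) ≤ -0.1 by norm_num) (show (-0.1 : ℝ) < 0 by norm_num)).Dtmin - 2 * A) *
        (bandBounds (show (-4 : ℝ) < -1.1 by norm_num) (show (-1.1 : ℝ) ≤ -0.1 by norm_num) (show (-0.1 : ℝ) < 0 by norm_num)).umin) *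
      ((bandBounds (show (-4 : ℝ) < -1.1 by norm_num) (show (-1.1 : ℝ) ≤ -0.1 by norm_num) (show (-0.1 : ℝ) < 0 by norm_num)).umin * (3 / 200) /
            (4 + 2 * A) * min (torusDist (ψ - χ)) (torusDist (ψ - χ - π)) -
        π * 7 * |ρ - e| / ((bandBounds (show (-4 : ℝ) < -1.1 by norm_num) (show (-1.1 : ℝ) ≤ -0.1 by norm_num)
          (show (-0.1 : ℝ) < 0 by norm_num)).Dtmin - 2 * A) ^ 2) ≤
      |fderiv ℝ (frameLevel μ K) (levelPoint μ K ρ ψ) (iteratedDeriv 1 (levelPoint μ K e) χ)| :=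
  abs_fderiv_frameLevel_levelPoint_tangent_ge hA hd hlo hhi hF.1 hρ he he₀ ψ χ

/-! ## §3 The transversality numbers of the two direct crossings of the pp loop -/

/-- **`|T_k| ≳ dist(ϑ, {0, π}) − O(|ρ|)`**: the slope of the partner band at the loop point `k = Φ(0,θ)` (partner `q′ = Φ(ρ, ϑ+θ)`), i.e.
`|De_K(Φ(ρ,ϑ+θ))[∂_sΦ(0,θ)]|` (c4a-1's `deriv_partnerBand_pp_angle_at_k`, up to sign), is bounded below by
`(2/π)(Dt_min − 2A)u_min·((u_min·w/(4+2A))·min(‖ϑ‖_𝕋, ‖ϑ − π‖_𝕋) − π·Kc·|ρ|/(Dt_min − 2A)²)`. [cite: BenfattoGiulianiMastropietro2003, §7.1 Lemma 7.1 (A1.9)] -/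
theorem abs_transversality_pp_at_k_ge {Kc r₀ g₀ w : ℝ} (hG : GeomConstants (frameLevel μ K) Kc r₀ g₀ w) {ρ : ℝ} (hρ : |ρ| < r) (ϑ θ : ℝ) :
    2 / π * (((bandBounds (show (-4 : ℝ) < -1.1 by norm_num) (show (-1.1 : ℝ) ≤ -0.1 by norm_num) (show (-0.1 : ℝ) < 0 by norm_num)).Dtmin - 2 * A) *
        (bandBounds (show (-4 : ℝ) < -1.1 by norm_num) (show (-1.1 : ℝ) ≤ -0.1 by norm_num) (show (-0.1 : ℝ) < 0 by norm_num)).umin) *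
      ((bandBounds (show (-4 : ℝ) < -1.1 by norm_num) (show (-1.1 : ℝ) ≤ -0.1 by norm_num) (show (-0.1 : ℝ) < 0 by norm_num)).umin * w /
            (4 + 2 * A) * min (torusDist ϑ) (torusDist (ϑ - π)) -
        π * Kc * |ρ| / ((bandBounds (show (-4 : ℝ) < -1.1 by norm_num) (show (-1.1 : ℝ) ≤ -0.1 by norm_num)
          (show (-0.1 : ℝ) < 0 by norm_num)).Dtmin - 2 * A) ^ 2) ≤
      |fderiv ℝ (frameLevel μ K) (levelPoint μ K ρ (ϑ + θ)) (iteratedDeriv 1 (levelPoint μ K 0) θ)| := by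
  have h0 : |(0 : ℝ)| < r := by simpa using hr
  have h0' : |(0 : ℝ)| < r₀ := by simpa using hG.r₀_pos
  have h := abs_fderiv_frameLevel_levelPoint_tangent_ge hA hd hlo hhi hG hρ h0 h0' (ϑ + θ) θ
  rwa [show ϑ + θ - θ = ϑ by ring, sub_zero] at h

/-- **`|T_q| ≳ dist(ϑ, {0, π}) − O(|ρ|)`**: the slope at the second crossing `q′ = Φ(ρ,ϑ+θ)` (partner `k`), `|De_K(Φ(0,θ))[∂_sΦ(ρ,ϑ+θ)]|`
(c4a-1's `deriv_partnerBand_pp_angle_at_q`), for `|ρ| < r₀`, has the same lower bound. [cite: BenfattoGiulianiMastropietro2003, §7.1 Lemma 7.1 (A1.9)] -/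
theorem abs_transversality_pp_at_q_ge {Kc r₀ g₀ w : ℝ} (hG : GeomConstants (frameLevel μ K) Kc r₀ g₀ w) {ρ : ℝ} (hρ : |ρ| < r) (hρ₀ : |ρ| < r₀)
    (ϑ θ : ℝ) :
    2 / π * (((bandBounds (show (-4 : ℝ) < -1.1 by norm_num) (show (-1.1 : ℝ) ≤ -0.1 by norm_num) (show (-0.1 : ℝ) < 0 by norm_num)).Dtmin - 2 * A) *
        (bandBounds (show (-4 : ℝ) < -1.1 by norm_num) (show (-1.1 : ℝ) ≤ -0.1 by norm_num) (show (-0.1 : ℝ) < 0 by norm_num)).umin) *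
      ((bandBounds (show (-4 : ℝ) < -1.1 by norm_num) (show (-1.1 : ℝ) ≤ -0.1 by norm_num) (show (-0.1 : ℝ) < 0 by norm_num)).umin * w /
            (4 + 2 * A) * min (torusDist ϑ) (torusDist (ϑ - π)) -
        π * Kc * |ρ| / ((bandBounds (show (-4 : ℝ) < -1.1 by norm_num) (show (-1.1 : ℝ) ≤ -0.1 by norm_num)
          (show (-0.1 : ℝ) < 0 by norm_num)).Dtmin - 2 * A) ^ 2) ≤
      |fderiv ℝ (frameLevel μ K) (levelPoint μ K 0 θ) (iteratedDeriv 1 (levelPoint μ K ρ) (ϑ + θ))| := by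
  have h0 : |(0 : ℝ)| < r := by simpa using hr
  have h := abs_fderiv_frameLevel_levelPoint_tangent_ge hA hd hlo hhi hG h0 hρ hρ₀ θ (ϑ + θ)
  have e1 : torusDist (θ - (ϑ + θ)) = torusDist ϑ := by
    rw [show θ - (ϑ + θ) = -ϑ by ring, torusDist_neg']
  have e2 : torusDist (θ - (ϑ + θ) - π) = torusDist (ϑ - π) := by
    rw [show θ - (ϑ + θ) - π = -(ϑ + π) by ring, torusDist_neg',
      show ϑ + π = ϑ - π + (1 : ℤ) * (2 * π) by push_cast; ring, torusDist_add_int_mul_two_pi]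
  rwa [e1, e2, zero_sub, abs_neg] at h

end Sizes

end Summit.HubbardSuperconductivity.HubbardSuperconductivity.Theorems.C4a

end
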